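import Literature.AnabelianGeometry.EtaleTheta.ThetaCoversAxioms
import Mathlib.GroupTheory.SemidirectProduct
import Mathlib.GroupTheory.Commutator.Basic
import Mathlib.Topology.Instances.ZMod
import Mathlib.Algebra.Group.TypeTags.Basic
import Mathlib.Algebra.Group.PUnit

/-!
# An ABELIAN-`Δ̄_X` inhabitant of `ThetaCovers.CoverDataAx` ([EtTh] §2, Def 2.1 / Prop 2.2 interface):
# the commutator law `⁅Δ_X, Δ_X⁆ · Ker = Δ̄_Θ` (GAP-LEDGER G-L2d3-1) is NOT a consequence of the typed interface

Mochizuki, *The Étale Theta Function and its Frobenioid-theoretic Manifestations* [EtTh], Publ. RIMS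
45 (2009), §2, Def 2.1 – Prop 2.2, pp.35–37 [cite: MochizukiEtTh2009, Def 2.1 p.36]: there `Δ̄_X` is the
mod-`l` HEISENBERG quotient of `Δ_X`, with `Δ̄_Θ = [Δ̄_X, Δ̄_X]` ("`Δ_Θ := Im(∧² Δ^ab_X)`", §1 p.12).
abc-iut-L2-t2's interface `ThetaCovers.CoverData` / `CoverDataAx` (ThetaCovers.lean, ThetaCoversAxioms.lean)
records `Δ̄_Θ` only through `relIndex_barKer = l`, `barTheta_central`, `ell_rank_two`, the `l`-th power law and
the `±1`-eigenvalue laws of the inversion; the cell's GAP-LEDGER row G-L2d3-1 carries the commutator law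
`hΘ : ⁅X.DeltaX, X.DeltaX⁆ ⊔ X.barKer = X.barTheta` as a NAMED HYPOTHESIS of [EtTh] Rmk 2.6.1 / Cor 2.9
(`ThetaCovers.TemperedCoverData.rmk261_of`), PROVED at every setting-born cover datum by abc-iut-L2-t11
(`ThetaSetting.PiCData.coverDataAx_hTheta`, Discharge/Sec2BarThetaCommutator.lean, p431249), and asserts in prose
that the abstract interface "admits models with `Δ̄_X` abelian … for which the printed Rmk 2.6.1 fails".

This file (abc-iut cell, seat abc-iut-w6-d041) is the KERNEL form of that prose: PURE FINITE GROUP THEORY,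
a CONSISTENCY/INDEPENDENCE WITNESS ONLY (no claim about print).  For every odd `l`:
* `Π_C := ((ℤ/l × ℤ/l) ⋊ C₂) × ℤ/l`, the generator of `C₂` acting on `(ℤ/l)²` by INVERSION (`negPow`), with the
  discrete topology; `G_K := 1`;
* `Π_X := ((ℤ/l)² ⋊ 1) × ℤ/l ≅ (ℤ/l)³` — ABELIAN, of index `2`; `Ker(Δ_X ↠ Δ̄_X) := 1`; `Δ̄_Θ := 1 × ℤ/l` (central,
  order `l`, fixed by the inversion); `Δ̄^ell_X = Δ_X/Δ̄_Θ ≅ (ℤ/l)²` on which the inversion acts by `−1`; `D_x := Δ̄_Θ`.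
All the axioms of `CoverDataAx l` hold (`abelianWitness`), while `⁅Δ_X, Δ_X⁆ = 1`, so
`⁅Δ_X, Δ_X⁆ ⊔ Ker = 1 ≠ Δ̄_Θ` as soon as `l ≠ 1`:
`not_forall_commutator_sup_barKer : ¬ ∀ X : CoverDataAx l, ⁅X.DeltaX, X.DeltaX⁆ ⊔ X.barKer = X.barTheta`.
CONSEQUENCE for the cell's bookkeeping: G-L2d3-1 is INDEPENDENT of `CoverDataAx` (so the binder `hΘ` of
`rmk261_of` cannot be dropped for ABSTRACT cover data), complementing L2-t11's theorem that it HOLDS for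
setting-born data.  Nothing here bears on [IUTchIII] Cor. 3.12; no side taken; typed ≠ proved.
-/

namespace Literature.AnabelianGeometry.EtaleTheta

namespace ThetaCovers

namespace AbelianWitness

open Multiplicative

variable (l : ℕ)

/-! ## 1. The group `Π_C = ((ℤ/l)² ⋊ C₂) × ℤ/l` -/

/-- `(ℤ/l)²`, written multiplicatively (plays `Δ̄^ell_X`). (toy bookkeeping; no claim about print)
[cite: MochizukiEtTh2009, Def 2.1 p.36] -/
abbrev N : Type := Multiplicative (ZMod l × ZMod l)

/-- `C₂ = ℤ/2`, written multiplicatively (the quotient `Π_C/Π_X = Gal(X/C)`). (toy bookkeeping; no claim about print)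
[cite: MochizukiEtTh2009, Def 2.1 p.36] -/
abbrev C2 : Type := Multiplicative (ZMod 2)

/-- `ℤ/l`, written multiplicatively (plays `Δ̄_Θ`). (toy bookkeeping; no claim about print)
[cite: MochizukiEtTh2009, Def 2.1 p.36] -/
abbrev Zl : Type := Multiplicative (ZMod l)

/-- The inversion automorphism of the abelian group `(ℤ/l)²`. (toy bookkeeping; no claim about print)
[cite: MochizukiEtTh2009, Rmk 2.1.1 p.36] -/
def negAut : MulAut (N l) := MulEquiv.inv (N l)

/-- `negAut` applied: `x ↦ x⁻¹`. (toy bookkeeping; no claim about print) [cite: MochizukiEtTh2009, Rmk 2.1.1 p.36] -/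
@[simp] theorem negAut_apply (x : N l) : negAut l x = x⁻¹ := rfl

/-- `negAut² = 1`. (toy bookkeeping; no claim about print) [cite: MochizukiEtTh2009, Rmk 2.1.1 p.36] -/
theorem negAut_sq : negAut l ^ 2 = 1 := by
  refine MulEquiv.ext fun x => ?_
  rw [pow_two, MulAut.mul_apply, negAut_apply, negAut_apply, inv_inv, MulAut.one_apply]

/-- The action `C₂ → Aut((ℤ/l)²)`: the generator acts by inversion (`e ↦ negAut ^ e`). (toy bookkeeping; no claim about
print) [cite: MochizukiEtTh2009, Rmk 2.1.1 p.36] -/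
def negPow : C2 →* MulAut (N l) where
  toFun e := negAut l ^ (toAdd e).val
  map_one' := by rw [toAdd_one, ZMod.val_zero, pow_zero]
  map_mul' a b := by
    rw [toAdd_mul, ZMod.val_add, ← pow_add]
    conv_rhs => rw [← Nat.mod_add_div ((toAdd a).val + (toAdd b).val) 2, pow_add, pow_mul, negAut_sq,
      one_pow, mul_one]

/-- The generator `g = 1 ∈ ℤ/2` of `C₂`. (toy bookkeeping; no claim about print) [cite: MochizukiEtTh2009, Def 2.1 p.36] -/
abbrev gen : C2 := ofAdd 1

/-- Every element of `C₂` is `1` or the generator. (toy bookkeeping; no claim about print) [cite: MochizukiEtTh2009, Def 2.1 p.36] -/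
theorem eq_one_or_eq_gen (e : C2) : e = 1 ∨ e = gen := by
  obtain ⟨a, rfl⟩ := ofAdd.surjective e
  fin_cases a
  · exact Or.inl rfl
  · exact Or.inr rfl

/-- The generator acts by inversion. (toy bookkeeping; no claim about print) [cite: MochizukiEtTh2009, Rmk 2.1.1 p.36] -/
theorem negPow_gen_apply (x : N l) : negPow l gen x = x⁻¹ := by
  change (negAut l ^ (toAdd (ofAdd (1 : ZMod 2))).val) x = x⁻¹
  rw [toAdd_ofAdd, ZMod.val_one, pow_one, negAut_apply]

/-- `(ℤ/l)² ⋊ C₂`, the generalised dihedral group of `(ℤ/l)²` (plays `Δ̄_X/Δ̄_Θ ⋊ Gal(X/C)`, i.e. `Π_C/Δ̄_Θ` with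
`G_K = 1`). (toy bookkeeping; no claim about print) [cite: MochizukiEtTh2009, Def 2.1 p.36] -/
abbrev SD : Type := N l ⋊[negPow l] C2

/-- **`Π_C` of the toy**: `((ℤ/l)² ⋊ C₂) × ℤ/l`. (toy bookkeeping; no claim about print) [cite: MochizukiEtTh2009, Def 2.1 p.36] -/
abbrev PiC : Type := SD l × Zl l

/-- The sign character `Π_C → C₂` (its kernel is `Π_X`). (toy bookkeeping; no claim about print) [cite: MochizukiEtTh2009, Def 2.1 p.36] -/
def sgn : PiC l →* C2 := SemidirectProduct.rightHom.comp (MonoidHom.fst _ _)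

/-- `sgn (x, t) = x.right`. (toy bookkeeping; no claim about print) [cite: MochizukiEtTh2009, Def 2.1 p.36] -/
@[simp] theorem sgn_apply (x : PiC l) : sgn l x = x.1.right := rfl

/-- **`Π_X` of the toy**: `Ker(sgn) = ((ℤ/l)² ⋊ 1) × ℤ/l` (abelian). (toy bookkeeping; no claim about print)
[cite: MochizukiEtTh2009, Def 2.1 p.36] -/
def PiX : Subgroup (PiC l) := (sgn l).ker

/-- Membership in `Π_X`: trivial `C₂`-component. (toy bookkeeping; no claim about print) [cite: MochizukiEtTh2009, Def 2.1 p.36] -/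
theorem mem_PiX {x : PiC l} : x ∈ PiX l ↔ x.1.right = 1 := by
  rw [PiX, MonoidHom.mem_ker, sgn_apply]

/-- **`Δ̄_Θ`-preimage of the toy** (also `D_x`): `1 × ℤ/l`, the kernel of the first projection. (toy bookkeeping; no claim
about print) [cite: MochizukiEtTh2009, Def 2.1 p.36] -/
def barTheta : Subgroup (PiC l) := (MonoidHom.fst (SD l) (Zl l)).ker

/-- Membership in `Δ̄_Θ`: trivial `((ℤ/l)² ⋊ C₂)`-component. (toy bookkeeping; no claim about print) [cite: MochizukiEtTh2009, Def 2.1 p.36] -/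
theorem mem_barTheta {x : PiC l} : x ∈ barTheta l ↔ x.1 = 1 := by
  rw [barTheta, MonoidHom.mem_ker, MonoidHom.coe_fst]

/-- `Δ̄_Θ ⊆ Π_X`. (toy bookkeeping; no claim about print) [cite: MochizukiEtTh2009, Def 2.1 p.36] -/
theorem barTheta_le_PiX : barTheta l ≤ PiX l := fun x hx => by
  rw [mem_PiX, (mem_barTheta l).mp hx, SemidirectProduct.one_right]

/-- `Δ̄_Θ = 1 × ℤ/l` is central in `Π_C`, hence normal. (toy bookkeeping; no claim about print) [cite: MochizukiEtTh2009, Def 2.1 p.36] -/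
theorem barTheta_comm {t : PiC l} (ht : t ∈ barTheta l) (g : PiC l) : g * t = t * g := by
  obtain ⟨a, u⟩ := t
  obtain ⟨b, v⟩ := g
  have ha : a = 1 := (mem_barTheta l).mp ht
  subst ha
  ext1
  · simp
  · exact mul_comm v u

/-- `Δ̄_Θ` is normal in `Π_C`. (toy bookkeeping; no claim about print) [cite: MochizukiEtTh2009, Def 2.1 p.36] -/
theorem barTheta_normal : (barTheta l).Normal := by
  refine ⟨fun t ht g => ?_⟩
  rw [barTheta_comm l ht g, mul_inv_cancel_right]
  exact ht

/-- Everything lies in the kernel of the trivial augmentation `Π_C → G_K = 1`. (toy bookkeeping; no claim about print)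
[cite: MochizukiEtTh2009, Def 2.1 p.36] -/
theorem ker_one_eq_top : (1 : PiC l →* PUnit.{1}).ker = ⊤ := MonoidHom.ker_one

/-- An element with trivial `C₂`-component is `inl` of its `(ℤ/l)²`-component. (toy bookkeeping; no claim about print)
[cite: MochizukiEtTh2009, Def 2.1 p.36] -/
theorem eq_inl_of_right {x : SD l} (hx : x.right = 1) : x = SemidirectProduct.inl x.left :=
  SemidirectProduct.ext (SemidirectProduct.left_inl _).symm (hx.trans (SemidirectProduct.right_inl _).symm)

/-! ## 2. `Δ̄^ell_X ≅ (ℤ/l)²`: the abelianisation coordinates -/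

/-- The `(ℤ/l)²`-coordinate on `Π_X` (a homomorphism, since the `C₂`-components are trivial there). (toy bookkeeping; no
claim about print) [cite: MochizukiEtTh2009, Def 2.1 p.36] -/
def ellCoords : ↥(PiX l ⊓ (1 : PiC l →* PUnit.{1}).ker) →* N l where
  toFun x := x.1.1.left
  map_one' := rfl
  map_mul' x y := by
    have hx : x.1.1.right = 1 := (mem_PiX l).mp x.2.1
    change (x.1.1 * y.1.1).left = x.1.1.left * y.1.1.left
    rw [SemidirectProduct.mul_left, hx, map_one, MulAut.one_apply]

/-- The coordinates are onto `(ℤ/l)²`. (toy bookkeeping; no claim about print) [cite: MochizukiEtTh2009, Def 2.1 p.36] -/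
theorem ellCoords_surjective : Function.Surjective (ellCoords l) := fun n =>
  ⟨⟨((SemidirectProduct.inl n : SD l), (1 : Zl l)),
    (mem_PiX l).mpr (SemidirectProduct.right_inl (φ := negPow l) n),
    by rw [ker_one_eq_top]; exact Subgroup.mem_top _⟩, SemidirectProduct.left_inl (φ := negPow l) n⟩

/-- The kernel of the coordinates is `Δ̄_Θ`. (toy bookkeeping; no claim about print) [cite: MochizukiEtTh2009, Def 2.1 p.36] -/
theorem ellCoords_ker : (ellCoords l).ker = (barTheta l).subgroupOf _ := by
  ext x
  rw [MonoidHom.mem_ker, Subgroup.mem_subgroupOf, mem_barTheta]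
  have hx : x.1.1.right = 1 := (mem_PiX l).mp x.2.1
  change x.1.1.left = 1 ↔ x.1.1 = 1
  constructor
  · intro h
    rw [eq_inl_of_right l hx, h, map_one]
  · intro h
    rw [h, SemidirectProduct.one_left]

/-! ## 3. Index, order, powers, commutators -/

/-- `[Π_C : Π_X] = 2`. (toy bookkeeping; no claim about print) [cite: MochizukiEtTh2009, Def 2.1 p.36] -/
theorem index_PiX : (PiX l).index = 2 := by
  have hsurj : Function.Surjective (sgn l) := fun e => ⟨(SemidirectProduct.inr e, 1), by simp⟩
  rw [PiX, Subgroup.index_ker, MonoidHom.range_eq_top.mpr hsurj, Subgroup.card_top,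
    Nat.card_eq_fintype_card, Fintype.card_multiplicative, ZMod.card]

/-- `Ker(pr₁) = 1 × ℤ/l ≃ ℤ/l`. (toy bookkeeping; no claim about print) [cite: MochizukiEtTh2009, Def 2.1 p.36] -/
def barThetaEquiv : ↥(barTheta l) ≃ ZMod l where
  toFun x := toAdd x.1.2
  invFun t := ⟨(1, ofAdd t), (mem_barTheta l).mpr rfl⟩
  left_inv x := by
    obtain ⟨⟨a, u⟩, h⟩ := x
    have ha : a = 1 := (mem_barTheta l).mp h
    subst ha
    rfl
  right_inv _ := rfl

/-- `|Δ̄_Θ| = l`. (toy bookkeeping; no claim about print) [cite: MochizukiEtTh2009, Def 2.1 p.36] -/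
theorem card_barTheta : Nat.card (barTheta l) = l := by
  rw [Nat.card_congr (barThetaEquiv l), Nat.card_zmod]

/-- `(ℤ/l)²` has exponent dividing `l`. (toy bookkeeping; no claim about print) [cite: MochizukiEtTh2009, Def 2.1 p.36] -/
theorem N_pow_l (n : N l) : n ^ l = 1 := by
  apply toAdd.injective
  rw [toAdd_pow, toAdd_one]
  ext <;> simp

/-- `ℤ/l` has exponent dividing `l`. (toy bookkeeping; no claim about print) [cite: MochizukiEtTh2009, Def 2.1 p.36] -/
theorem Zl_pow_l (t : Zl l) : t ^ l = 1 := by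
  apply toAdd.injective
  rw [toAdd_pow, toAdd_one]
  simp

/-- `Π_X` has exponent dividing `l`. (toy bookkeeping; no claim about print) [cite: MochizukiEtTh2009, Def 2.1 p.36] -/
theorem pow_l_eq_one {d : PiC l} (hd : d ∈ PiX l) : d ^ l = 1 := by
  obtain ⟨a, u⟩ := d
  have ha : a = SemidirectProduct.inl a.left := eq_inl_of_right l ((mem_PiX l).mp hd)
  rw [ha]
  ext1
  · rw [Prod.pow_fst, Prod.fst_one, ← map_pow, N_pow_l, map_one]
  · rw [Prod.pow_snd, Prod.snd_one, Zl_pow_l]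

/-- `Π_X` is ABELIAN: any two of its elements commute. (toy bookkeeping; no claim about print) [cite: MochizukiEtTh2009, Def 2.1 p.36] -/
theorem PiX_comm {x y : PiC l} (hx : x ∈ PiX l) (hy : y ∈ PiX l) : x * y = y * x := by
  obtain ⟨a, u⟩ := x
  obtain ⟨b, v⟩ := y
  have ha : a = SemidirectProduct.inl a.left := eq_inl_of_right l ((mem_PiX l).mp hx)
  have hb : b = SemidirectProduct.inl b.left := eq_inl_of_right l ((mem_PiX l).mp hy)
  rw [ha, hb]
  ext1
  · rw [Prod.fst_mul, Prod.fst_mul, ← map_mul, ← map_mul, mul_comm]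
  · exact mul_comm u v

/-- Hence `⁅Π_X, Π_X⁆ = 1`. (toy bookkeeping; no claim about print) [cite: MochizukiEtTh2009, Def 2.1 p.36] -/
theorem commutator_PiX_eq_bot : ⁅PiX l, PiX l⁆ = ⊥ := by
  rw [Subgroup.commutator_eq_bot_iff_le_centralizer]
  intro x hx
  rw [Subgroup.mem_centralizer_iff]
  intro y hy
  exact PiX_comm l hy hx

/-- The inversion law: for `c ∉ Π_X` and `d ∈ Π_X`, `c d c⁻¹ d ∈ Δ̄_Θ` (the inversion acts by `−1` on `Δ̄^ell_X`).
(toy bookkeeping; no claim about print) [cite: MochizukiEtTh2009, Rmk 2.1.1 p.36] -/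
theorem inv_ell_law {c d : PiC l} (hc : c ∉ PiX l) (hd : d ∈ PiX l) : c * d * c⁻¹ * d ∈ barTheta l := by
  obtain ⟨a, u⟩ := c
  obtain ⟨b, v⟩ := d
  have hb : b = SemidirectProduct.inl b.left := eq_inl_of_right l ((mem_PiX l).mp hd)
  have ha : a.right = gen := by
    rcases eq_one_or_eq_gen a.right with h | h
    · exact absurd ((mem_PiX l).mpr h) hc
    · exact h
  have ha' : a = SemidirectProduct.inl a.left * SemidirectProduct.inr gen := by
    rw [← ha]; exact (SemidirectProduct.inl_left_mul_inr_right a).symm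
  rw [mem_barTheta]
  change a * b * a⁻¹ * b = 1
  -- in the generalised dihedral group: `(m, g) · n · (m, g)⁻¹ · n = m · n⁻¹ · m⁻¹ · n = 1`
  set m := a.left
  set n := b.left
  rw [hb, ha']
  calc SemidirectProduct.inl m * SemidirectProduct.inr gen * SemidirectProduct.inl n *
        (SemidirectProduct.inl m * SemidirectProduct.inr gen)⁻¹ * SemidirectProduct.inl n
      = SemidirectProduct.inl m *
          (SemidirectProduct.inr gen * SemidirectProduct.inl n * (SemidirectProduct.inr gen)⁻¹) *
          (SemidirectProduct.inl m)⁻¹ * SemidirectProduct.inl n := by group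
    _ = SemidirectProduct.inl (m * n⁻¹ * m⁻¹ * n) := by
        rw [← map_inv (SemidirectProduct.inr (N := N l) (φ := negPow l)) gen,
          ← SemidirectProduct.inl_aut, negPow_gen_apply, ← map_inv, ← map_mul, ← map_mul, ← map_mul]
    _ = 1 := by
        have h1 : m * n⁻¹ * m⁻¹ * n = 1 := by
          apply toAdd.injective
          simp only [toAdd_mul, toAdd_inv, toAdd_one]
          abel
        rw [h1, map_one]

/-! ## 4. The witness and the independence of the commutator law -/

/-- **THE ABELIAN WITNESS**: for every odd `l`, `((ℤ/l)² ⋊ C₂) × ℤ/l` with the data above is a `CoverDataAx l`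
(discrete topology, `G_K = 1`, `Ker(Δ_X ↠ Δ̄_X) = 1`, `D_x = Δ̄_Θ`) whose `Δ_X = Π_X` is ABELIAN.
CONSISTENCY/INDEPENDENCE WITNESS ONLY — not a claim of faithfulness to print (in print `Δ̄_X` is the
non-abelian Heisenberg group). [cite: MochizukiEtTh2009, Def 2.1 p.36] -/
@[reducible] def abelianWitness (hl : Odd l) : CoverDataAx.{0} l :=
  letI : TopologicalSpace (PiC l) := ⊥
  haveI : DiscreteTopology (PiC l) := ⟨rfl⟩
  haveI := barTheta_normal l
  { l_odd := hl
    PiC := PiC l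
    GK := PUnit
    aug := 1
    PiX := PiX l
    PiX_normal := MonoidHom.normal_ker _
    index_PiX := index_PiX l
    isOpen_PiX := isOpen_discrete _
    aug_PiX_surjective := fun _ => ⟨1, Subsingleton.elim _ _⟩
    barKer := ⊥
    barKer_normal := inferInstance
    isClosed_barKer := isClosed_discrete _
    barTheta := barTheta l
    barTheta_normal := barTheta_normal l
    barKer_le_barTheta := bot_le
    barTheta_le := by rw [MonoidHom.ker_one, inf_top_eq]; exact barTheta_le_PiX l
    relIndex_barKer := by rw [Subgroup.relIndex_bot_left, card_barTheta]
    ell_rank_two := ⟨(QuotientGroup.quotientMulEquivOfEq (ellCoords_ker l).symm).trans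
      (QuotientGroup.quotientKerEquivOfSurjective _ (ellCoords_surjective l))⟩
    barTheta_central := by
      intro t ht d _
      rw [Subgroup.mem_bot, ← barTheta_comm l ht d, mul_inv_cancel_right, mul_inv_cancel]
    Dx := barTheta l
    Dx_le := barTheta_le_PiX l
    aug_Dx_surjective := fun _ => ⟨1, Subsingleton.elim _ _⟩
    inertia_sup_barKer := by rw [MonoidHom.ker_one, inf_top_eq, sup_bot_eq]
    pow_mem_barKer := by
      intro d hd
      rw [MonoidHom.ker_one, inf_top_eq] at hd
      rw [Subgroup.mem_bot]
      exact pow_l_eq_one l hd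
    inv_ell := by
      intro c _ hc d hd
      rw [MonoidHom.ker_one, inf_top_eq] at hd
      exact inv_ell_law l hc hd
    inv_theta := by
      intro c _ _ t ht
      rw [Subgroup.mem_bot, barTheta_comm l ht c, mul_inv_cancel_right, mul_inv_cancel] }

/-- At the abelian witness the commutator law FAILS: `⁅Δ_X, Δ_X⁆ ⊔ Ker = 1` while `Δ̄_Θ ≅ ℤ/l ≠ 1` (`l ≠ 1`).
[cite: MochizukiEtTh2009, Def 2.1 p.36] -/
theorem commutator_sup_barKer_ne (hl : Odd l) (hl1 : l ≠ 1) :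
    ⁅(abelianWitness l hl).DeltaX, (abelianWitness l hl).DeltaX⁆ ⊔ (abelianWitness l hl).barKer ≠
      (abelianWitness l hl).barTheta := by
  haveI : Fact (1 < l) := ⟨by obtain ⟨k, hk⟩ := hl; omega⟩
  intro h
  have hX : (abelianWitness l hl).DeltaX = PiX l := by
    change PiX l ⊓ (1 : PiC l →* PUnit.{1}).ker = PiX l
    rw [MonoidHom.ker_one, inf_top_eq]
  have hbot : ⁅(abelianWitness l hl).DeltaX, (abelianWitness l hl).DeltaX⁆ ⊔ (abelianWitness l hl).barKer = ⊥ := by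
    rw [hX, commutator_PiX_eq_bot]
    exact bot_sup_eq _
  rw [hbot] at h
  -- `(1, ofAdd 1) ∈ Δ̄_Θ` is not `1` since `1 ≠ 0` in `ℤ/l`
  have hmem : ((1, ofAdd (1 : ZMod l)) : PiC l) ∈ barTheta l := (mem_barTheta l).mpr rfl
  have h1 : ((1, ofAdd (1 : ZMod l)) : PiC l) ∈ (⊥ : Subgroup (PiC l)) := by
    have e : (⊥ : Subgroup (PiC l)) = barTheta l := h
    rw [e]; exact hmem
  rw [Subgroup.mem_bot, Prod.mk_eq_one] at h1
  have h2 : (1 : ZMod l) = 0 := by simpa using congrArg toAdd h1.2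
  exact one_ne_zero h2

/-- **G-L2d3-1 is independent of the interface**: for every odd `l ≠ 1`, the commutator law
`⁅Δ_X, Δ_X⁆ ⊔ Ker(Δ_X ↠ Δ̄_X) = Δ̄_Θ` is NOT a theorem of `ThetaCovers.CoverDataAx l` (it fails at the abelian
witness) — so it must be carried as a hypothesis for ABSTRACT cover data (`TemperedCoverData.rmk261_of (hΘ)`), while
it is a THEOREM for setting-born data (`ThetaSetting.PiCData.coverDataAx_hTheta`, abc-iut-L2-t11). Says nothing
about [EtTh] itself. [cite: MochizukiEtTh2009, Def 2.1 p.36] -/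
theorem not_forall_commutator_sup_barKer (hl : Odd l) (hl1 : l ≠ 1) :
    ¬ ∀ X : CoverDataAx.{0} l, ⁅X.DeltaX, X.DeltaX⁆ ⊔ X.barKer = X.barTheta :=
  fun h => commutator_sup_barKer_ne l hl hl1 (h (abelianWitness l hl))

/-- The instance `l = 3`: a `CoverDataAx 3` with abelian `Δ̄_X` violating the commutator law.
[cite: MochizukiEtTh2009, Def 2.1 p.36] -/
theorem not_forall_commutator_sup_barKer_three :
    ¬ ∀ X : CoverDataAx.{0} 3, ⁅X.DeltaX, X.DeltaX⁆ ⊔ X.barKer = X.barTheta :=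
  not_forall_commutator_sup_barKer 3 (by decide) (by decide)

end AbelianWitness

end ThetaCovers

end Literature.AnabelianGeometry.EtaleTheta
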